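import Summits.AtomisticToContinuum.BoseEinsteinCondensation.Theses.BECChargeConjugationRP

/-!
# `Assembly` (item stmt-AtomisticToContinuum-9050 of route BECChargeConjugationRP)

`Assembly := ChargedAnchorLRO → DialPersistence → CornerTransfer → BoundaryTransferWeak →
ScatteringLengthTransfer → BornRepresentativesExist → ScatteringLengthFinite → BoseEinsteinCondensation`
— verbatim the type of the route's deciding theorem `closes`. Pure logic plus `ENNReal.ofReal_toReal`:
for an admissible `w` put `a := (scatteringLength w).toReal` (`≠ ⊤` by `ScatteringLengthFinite`);
`CornerTransfer (DialPersistence ChargedAnchorLRO)` gives the Born window `ε₀` and periodic constant-mode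
BEC for every Born-regime potential; `BornRepresentativesExist` supplies a bounded Born-regime `v` with
`scatteringLength v = ofReal a = scatteringLength w`; `BoundaryTransferWeak` turns its periodic BEC into
`HasGroundStateBEC v ρ` for small `ρ`, and `ScatteringLengthTransfer v w` carries it to `w`.

The proof is written out (rather than `exact closes`) so that this file does not depend on the
planner-authored glue term; all mathematical content lives in the seven hypotheses, which are the
route's statement items. Nothing else is here.
-/

namespace Summit.AtomisticToContinuum.BoseEinsteinCondensation.Theorems

open Summit.AtomisticToContinuum.BoseEinsteinCondensation.Theses.BECChargeConjugationRP
open Literature.MathematicalPhysics.QuantumManyBody.BoseGas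

/-- **`Assembly`** (item stmt-AtomisticToContinuum-9050 of route BECChargeConjugationRP, concluded BY
NAME): `ChargedAnchorLRO → DialPersistence → CornerTransfer → BoundaryTransferWeak →
ScatteringLengthTransfer → BornRepresentativesExist → ScatteringLengthFinite → BoseEinsteinCondensation`.
Given an admissible `w`, `CornerTransfer (DialPersistence ChargedAnchorLRO)` yields the Born window `ε₀`;
`BornRepresentativesExist ε₀ _ (scatteringLength w).toReal` yields a bounded Born-regime `v` of the same
scattering length (`ENNReal.ofReal_toReal`, finiteness from `ScatteringLengthFinite`); its periodic BEC
(`CornerTransfer`) becomes Dirichlet ground-state BEC by `BoundaryTransferWeak` and is transferred to `w`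
by `ScatteringLengthTransfer`. Same term as the route's deciding theorem `closes`. [folklore] -/
theorem becChargeConjugationRP_assembly_proof :
    Summit.AtomisticToContinuum.BoseEinsteinCondensation.Theses.BECChargeConjugationRP.Assembly := by
  unfold Summit.AtomisticToContinuum.BoseEinsteinCondensation.Theses.BECChargeConjugationRP.Assembly
  intro h3 h4 h5 h6 h7 h8 h9 w hw
  obtain ⟨ε₀, hε₀, hcorner⟩ := h5 (h4 h3)
  obtain ⟨v, hv, hvM, hvBorn, hva⟩ := h8 ε₀ hε₀ _
    (ENNReal.toReal_nonneg (a := scatteringLength w))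
  have hsl : scatteringLength v = scatteringLength w := by
    rw [hva, ENNReal.ofReal_toReal (h9 w hw)]
  exact h7 v w hv hw hvM hsl (h6 v hv (hcorner v hv hvBorn))

end Summit.AtomisticToContinuum.BoseEinsteinCondensation.Theorems
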